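import Summits.QuantumAdvantage.QuantumAdvantage.Statement
import Mathlib.Algebra.Order.BigOperators.Group.Finset
import Mathlib.Data.Finset.Powerset
import Mathlib.Data.Real.Basic
import Mathlib.Tactic.FieldSimp
import Mathlib.Tactic.Linarith
import HarnessLib

/-!
# The combinatorial core of the generic-oracle rung: heavy variables, certificates, rounds

Solo/blind wall, §1l rider (α) (v14). The category rung of `QuantumAdvantage` is
`G1 := "{A | BQP^A ⊄ BPP^A} is comeagre"`; the kernel file `SoloBlindCategory` proves
`QuantumAdvantage → G1` (one oracle-free witness, `GENERIC-BPP = BPP`). Upward, print had only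
Fortnow–Rogers 1999, Thm. 3.6 (= Fenner–Fortnow–Kurtz–Li, *An oracle builder's toolkit*,
Thm. 6.18(2), via Impagliazzo–Naor certificate search in `FP^{Σ₂ᵖ}` and Nisan–Szegedy):
unrelativized `P = PSPACE` gives `P^G = BQP^G` for every Cohen-generic `G`, i.e. `G1 → P ≠ PSPACE`.

Theorem G of the wall (v14, prose, `paper/generic-rung.md`) lowers the hypothesis to the promise
level: **`PromiseBQP ⊆ PromiseBPP → BQP^G ⊆ BPP^G` for every Cohen-generic `G`**, hence
`QuantumAdvantage → G1 → (PromiseBQP ⊄ PromiseBPP)` — the category rung lies inside the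
promise/language gap of the summit itself. Its proof simulates a *categorical* (bounded-error for
every oracle) quantum machine `M` on input `x` by a classical learner that, in each round, asks the
true oracle for every string carrying query weight `≥ δ` in the run of `M` on the current
hypothesis oracle (weights are acceptance probabilities of explicit circuits, estimable at the
`PromiseBQP` level), and stops after `2·bs + 1` rounds. Three ingredients are analytic or
topological and stay in prose (the Bennett–Bernstein–Brassard–Vazirani hybrid bound, Baire
category / categoricity on a cone, `PromiseBQP` estimation by threshold scan). The remaining,
purely combinatorial core is certified here, for an arbitrary Boolean function `f` of finitely
many Boolean variables (the oracle bits `M` can reach on inputs of length `n`). A *sensitive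
block* of `f` at `z` is a set `B` of variables with `f (z^B) ≠ f z`; `soloBlindMinBlocks f z` is
the family of inclusion-minimal ones.

* `soloBlind_exists_minBlock` — every sensitive block contains a minimal sensitive block;
* `soloBlind_minBlock_subset_sensSet` — **a minimal sensitive block at `z` consists of variables
  that are sensitive at the flipped point** (so its size is at most the sensitivity, hence at most
  the block sensitivity, hence `poly(T)` for a `T`-query bounded-error machine — Nisan, BBCMW);
* `soloBlind_certificate_of_hitting` — **a set of variables meeting every minimal sensitive block
  at `z` is a certificate at `z`** (fixing it to `z`'s values fixes `f`);
* `soloBlind_heavy_hits`, `soloBlind_heavy_certificate` — if every sensitive block at `z` carries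
  total weight `≥ c > 0` (the hybrid / union bound for the machine run on `z`) and minimal
  sensitive blocks have `≤ m` elements, then **the variables of weight `≥ c/m` form a
  certificate at `z`** — this is what one round of the learner queries;
* `soloBlind_rounds_disjoint_blocks`, `soloBlind_rounds_card_le`, `soloBlind_rounds_constant` —
  **the mixed-label round bound**: if in each of `R` rounds the learner queried (inside the newly
  learned variables) a certificate `C i`, valid on the subcube of the then-known answers, for the
  value `b i` of `f` at the then-current hypothesis, and some point `z₀` of the final subcube has
  `f z₀ ≠ b i` for `k` of the rounds, then `z₀` has `k` pairwise disjoint sensitive blocks; so if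
  every point has at most `β` pairwise disjoint sensitive blocks and `R > 2β`, then `f` is
  constant on the final subcube (and the learner's last hypothesis value is the true value).
  The classical one-label form of this argument is the `D(f) ≤ C(f)·bs(f)` bound
  (Blum–Impagliazzo, Hartmanis–Hemachandra, Tardos; Beals–Buhrman–Cleve–Mosca–de Wolf §5); the
  learner's labels vary from round to round, which costs the factor `2`.

Nothing here mentions machines: the file is the machine-free part of the argument, and it is
also the machine-free part of the classical statement "`Promise-BPP` easy `→ BPP^G = P^G` for
Cohen-generic `G`" (same learner with the union bound in place of the hybrid bound), which
sharpens Fenner–Fortnow–Kurtz–Li Thm. 6.18(1) (`P = NP → BPP^G = P^G`) in the same way.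

References. L. Fortnow, J. Rogers, *Complexity limitations on quantum computation*, JCSS 59
(1999), Thm. 3.6, §4 [arXiv:cs/9811023]. S. Fenner, L. Fortnow, S. Kurtz, L. Li, *An oracle
builder's toolkit*, Inform. and Comput. 182 (2003), Lemmas 6.16–6.17, Thm. 6.18
[doi:10.1016/S0890-5401(03)00018-X]. S. Cook, R. Impagliazzo, T. Yamakami, *A tight relationship
between generic oracles and type-2 complexity theory*, Inform. and Comput. 137 (1997), Thm. 3.2,
Prop. 4.2. C. Bennett, E. Bernstein, G. Brassard, U. Vazirani, *Strengths and weaknesses of quantum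
computing*, SIAM J. Comput. 26 (1997), Thm. 3.3. N. Nisan, *CREW PRAMs and decision trees*, SIAM J.
Comput. 20 (1991). R. Beals, H. Buhrman, R. Cleve, M. Mosca, R. de Wolf, *Quantum lower bounds by
polynomials*, J. ACM 48 (2001), §5.
-/

namespace Summit.QuantumAdvantage.QuantumAdvantage.Theorems

open Finset

section Core

variable {V : Type*} [DecidableEq V]

/-- Flip the table `z` on the block `B` (notation in the docstrings: `z^B`). -/
def soloBlindFlip (z : V → Bool) (B : Finset V) : V → Bool :=
  fun v => if v ∈ B then !z v else z v

/-- Value of the flipped table inside the block. -/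
@[simp] theorem soloBlindFlip_apply_of_mem {z : V → Bool} {B : Finset V} {v : V} (h : v ∈ B) :
    soloBlindFlip z B v = !z v := by simp [soloBlindFlip, h]

/-- Value of the flipped table outside the block. -/
@[simp] theorem soloBlindFlip_apply_of_not_mem {z : V → Bool} {B : Finset V} {v : V}
    (h : v ∉ B) : soloBlindFlip z B v = z v := by simp [soloBlindFlip, h]

/-- Flipping on the empty block does nothing. -/
@[simp] theorem soloBlindFlip_empty (z : V → Bool) : soloBlindFlip z ∅ = z := by
  funext v; simp [soloBlindFlip]

/-- Flipping `z` on exactly the set where `z'` differs from `z` gives `z'`. -/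
theorem soloBlindFlip_filter_ne [Fintype V] (z z' : V → Bool) :
    soloBlindFlip z (Finset.univ.filter fun v => z' v ≠ z v) = z' := by
  funext v
  by_cases h : z' v = z v
  · simp [soloBlindFlip, h]
  · have h' : (!z v) = z' v := by
      cases hz : z v <;> cases hz' : z' v <;> simp_all
    simp [soloBlindFlip, h, h']

/-- Flipping one variable `v ∈ B` back: `(z^B)^{v} = z^{B ∖ {v}}`. -/
theorem soloBlindFlip_flip_singleton {z : V → Bool} {B : Finset V} {v : V} (hv : v ∈ B) :
    soloBlindFlip (soloBlindFlip z B) {v} = soloBlindFlip z (B.erase v) := by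
  funext u
  by_cases huv : u = v
  · subst huv; simp [soloBlindFlip, hv]
  · by_cases hu : u ∈ B
    · simp [soloBlindFlip, huv, hu]
    · simp [soloBlindFlip, huv, hu]

/-- The empty block is never sensitive. -/
theorem soloBlind_flip_empty_eq (f : (V → Bool) → Bool) (z : V → Bool) :
    f (soloBlindFlip z ∅) = f z := by
  simp

/-- A sensitive block is nonempty. -/
theorem soloBlind_nonempty_of_sensitive {f : (V → Bool) → Bool} {z : V → Bool} {B : Finset V}
    (h : f (soloBlindFlip z B) ≠ f z) : B.Nonempty := by
  rw [Finset.nonempty_iff_ne_empty]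
  rintro rfl
  exact h (soloBlind_flip_empty_eq f z)

/-- The family of **minimal sensitive blocks** of `f` at `z`: blocks `B` with `f (z^B) ≠ f z`
no proper sub-block of which changes the value of `f`. -/
def soloBlindMinBlocks (f : (V → Bool) → Bool) (z : V → Bool) : Set (Finset V) :=
  {B | f (soloBlindFlip z B) ≠ f z ∧ ∀ B', B' ⊂ B → f (soloBlindFlip z B') = f z}

/-- Unfolding membership in the family of minimal sensitive blocks. -/
theorem soloBlind_mem_minBlocks {f : (V → Bool) → Bool} {z : V → Bool} {B : Finset V} :
    B ∈ soloBlindMinBlocks f z ↔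
      (f (soloBlindFlip z B) ≠ f z ∧ ∀ B', B' ⊂ B → f (soloBlindFlip z B') = f z) :=
  Iff.rfl

/-- A minimal sensitive block is nonempty. -/
theorem soloBlind_nonempty_of_mem_minBlocks {f : (V → Bool) → Bool} {z : V → Bool}
    {B : Finset V} (h : B ∈ soloBlindMinBlocks f z) : B.Nonempty :=
  soloBlind_nonempty_of_sensitive h.1

/-- Every sensitive block contains a minimal sensitive block (take one of least cardinality). -/
theorem soloBlind_exists_minBlock {f : (V → Bool) → Bool} {z : V → Bool} {D : Finset V}
    (hD : f (soloBlindFlip z D) ≠ f z) : ∃ B, B ⊆ D ∧ B ∈ soloBlindMinBlocks f z := by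
  classical
  have hDS : D ∈ (D.powerset.filter fun B => f (soloBlindFlip z B) ≠ f z) :=
    Finset.mem_filter.mpr ⟨Finset.mem_powerset.mpr (Finset.Subset.refl D), hD⟩
  obtain ⟨B, hB, hmin⟩ :=
    (D.powerset.filter fun B => f (soloBlindFlip z B) ≠ f z).exists_min_image Finset.card
      ⟨D, hDS⟩
  simp only [Finset.mem_filter, Finset.mem_powerset] at hB
  refine ⟨B, hB.1, hB.2, fun B' hB' => ?_⟩
  by_contra hsens
  have hB'S : B' ∈ (D.powerset.filter fun B => f (soloBlindFlip z B) ≠ f z) := by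
    simp only [Finset.mem_filter, Finset.mem_powerset]
    exact ⟨hB'.1.trans hB.1, hsens⟩
  exact absurd (Finset.card_lt_card hB') (not_lt.mpr (hmin B' hB'S))

variable [Fintype V]

/-- The set of sensitive variables of `f` at `z` (its cardinality is the sensitivity `s(f, z)`). -/
def soloBlindSensSet (f : (V → Bool) → Bool) (z : V → Bool) : Finset V :=
  Finset.univ.filter fun v => f (soloBlindFlip z {v}) ≠ f z

/-- **A minimal sensitive block at `z` consists of variables sensitive at the flipped point
`z^B`.** Consequently `|B| ≤ s(f, z^B) ≤ s(f) ≤ bs(f)` (Nisan 1991). -/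
theorem soloBlind_minBlock_subset_sensSet {f : (V → Bool) → Bool} {z : V → Bool}
    {B : Finset V} (h : B ∈ soloBlindMinBlocks f z) :
    B ⊆ soloBlindSensSet f (soloBlindFlip z B) := by
  intro v hv
  simp only [soloBlindSensSet, Finset.mem_filter, Finset.mem_univ, true_and]
  rw [soloBlindFlip_flip_singleton hv, h.2 (B.erase v) (Finset.erase_ssubset hv)]
  exact fun h' => h.1 h'.symm

/-- Cardinality form: a minimal sensitive block at `z` has at most `s(f, z^B)` elements. -/
theorem soloBlind_card_minBlock_le {f : (V → Bool) → Bool} {z : V → Bool} {B : Finset V}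
    (h : B ∈ soloBlindMinBlocks f z) :
    B.card ≤ (soloBlindSensSet f (soloBlindFlip z B)).card :=
  Finset.card_le_card (soloBlind_minBlock_subset_sensSet h)

/-- **A set of variables that meets every minimal sensitive block of `f` at `z` is a certificate
at `z`**: any table agreeing with `z` on `K` has the same `f`-value. -/
theorem soloBlind_certificate_of_hitting {f : (V → Bool) → Bool} {z : V → Bool} {K : Finset V}
    (hK : ∀ B ∈ soloBlindMinBlocks f z, (B ∩ K).Nonempty) :
    ∀ z' : V → Bool, (∀ v ∈ K, z' v = z v) → f z' = f z := by
  intro z' hz'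
  by_contra hne
  have hsens : f (soloBlindFlip z (Finset.univ.filter fun v => z' v ≠ z v)) ≠ f z := by
    rw [soloBlindFlip_filter_ne]
    exact hne
  obtain ⟨B, hBD, hB⟩ := soloBlind_exists_minBlock hsens
  obtain ⟨v, hv⟩ := hK B hB
  rw [Finset.mem_inter] at hv
  have hvD := hBD hv.1
  simp only [Finset.mem_filter, Finset.mem_univ, true_and] at hvD
  exact hvD (hz' v hv.2)

omit [Fintype V] in
/-- **Heavy variables meet every minimal sensitive block.** If every sensitive block at `z`
carries total weight at least `c > 0` and minimal sensitive blocks at `z` have at most `m`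
elements, then every minimal sensitive block at `z` contains a variable of weight `≥ c / m`. -/
theorem soloBlind_heavy_hits {f : (V → Bool) → Bool} {z : V → Bool} (w : V → ℝ) {c m : ℝ}
    (hc : 0 < c) (hm : 0 < m)
    (hyb : ∀ B, f (soloBlindFlip z B) ≠ f z → c ≤ ∑ v ∈ B, w v)
    (hsize : ∀ B ∈ soloBlindMinBlocks f z, (B.card : ℝ) ≤ m) :
    ∀ B ∈ soloBlindMinBlocks f z, ∃ v ∈ B, c / m ≤ w v := by
  intro B hB
  by_contra hno
  push Not at hno
  have hlt : ∑ v ∈ B, w v < ∑ _v ∈ B, c / m :=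
    Finset.sum_lt_sum_of_nonempty (soloBlind_nonempty_of_mem_minBlocks hB) fun v hv => hno v hv
  rw [Finset.sum_const, nsmul_eq_mul] at hlt
  have hcm : 0 ≤ c / m := div_nonneg hc.le hm.le
  have hle : (B.card : ℝ) * (c / m) ≤ m * (c / m) :=
    mul_le_mul_of_nonneg_right (hsize B hB) hcm
  have hm0 : m ≠ 0 := hm.ne'
  have hmc : m * (c / m) = c := by
    field_simp
  linarith [hyb B hB.1]

/-- **One round of the learner queries a certificate**: under the hypotheses of
`soloBlind_heavy_hits`, the variables of weight `≥ c / m` form a certificate of `f` at `z`. -/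
theorem soloBlind_heavy_certificate {f : (V → Bool) → Bool} {z : V → Bool} (w : V → ℝ)
    {c m : ℝ} (hc : 0 < c) (hm : 0 < m)
    (hyb : ∀ B, f (soloBlindFlip z B) ≠ f z → c ≤ ∑ v ∈ B, w v)
    (hsize : ∀ B ∈ soloBlindMinBlocks f z, (B.card : ℝ) ≤ m) :
    ∀ z' : V → Bool, (∀ v, c / m ≤ w v → z' v = z v) → f z' = f z := by
  intro z' hz'
  refine soloBlind_certificate_of_hitting (K := Finset.univ.filter fun v => c / m ≤ w v) ?_ z' ?_
  · intro B hB
    obtain ⟨v, hvB, hv⟩ := soloBlind_heavy_hits w hc hm hyb hsize B hB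
    exact ⟨v, Finset.mem_inter.mpr ⟨hvB, by simp [hv]⟩⟩
  · intro v hv
    simp only [Finset.mem_filter, Finset.mem_univ, true_and] at hv
    exact hz' v hv

/-! ### The mixed-label round bound -/

/-- The sensitive block extracted from round `i` at the point `z₀`: the variables of the round-`i`
certificate `C i` on which `z₀` disagrees with the round-`i` hypothesis `h i`. -/
def soloBlindRoundBlock (C : ℕ → Finset V) (h : ℕ → V → Bool) (z₀ : V → Bool) (i : ℕ) :
    Finset V :=
  (C i).filter fun v => z₀ v ≠ h i v

omit [Fintype V] in
/-- **Rounds with a wrong label give pairwise disjoint sensitive blocks.** Data: known sets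
`K 0 ⊆ K 1 ⊆ ⋯` (monotone), the true table `y`, hypotheses `h i`, and for each round `i < R` a
set `C i` of variables learned in that round (`C i ⊆ K (i+1)`, `C i ∩ K i = ∅`) that is a
certificate for the value `b i` on the subcube of tables agreeing with `y` on `K i`:
every table agreeing with `y` on `K i` and with `h i` on `C i` has `f`-value `b i`.
Then at any point `z₀` of the final subcube, every round with `b i ≠ f z₀` yields a nonempty
sensitive block inside `C i`, and these blocks are pairwise disjoint. -/
theorem soloBlind_rounds_disjoint_blocks {f : (V → Bool) → Bool} {R : ℕ} {K : ℕ → Finset V}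
    (hmono : ∀ i j, i ≤ j → K i ⊆ K j) {y : V → Bool} {h : ℕ → V → Bool} {C : ℕ → Finset V}
    {b : ℕ → Bool} (hC : ∀ i < R, C i ⊆ K (i + 1)) (hCK : ∀ i < R, Disjoint (C i) (K i))
    (hcert : ∀ i < R, ∀ z : V → Bool,
      (∀ v ∈ K i, z v = y v) → (∀ v ∈ C i, z v = h i v) → f z = b i)
    {z₀ : V → Bool} (hz₀ : ∀ v ∈ K R, z₀ v = y v) :
    (∀ i < R, b i ≠ f z₀ → (soloBlindRoundBlock C h z₀ i).Nonempty) ∧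
    (∀ i < R, b i ≠ f z₀ → f (soloBlindFlip z₀ (soloBlindRoundBlock C h z₀ i)) ≠ f z₀) ∧
    (∀ i j, i < R → j < R → i ≠ j →
      Disjoint (soloBlindRoundBlock C h z₀ i) (soloBlindRoundBlock C h z₀ j)) := by
  have hKR : ∀ i < R, ∀ v ∈ K i, z₀ v = y v := fun i hi v hv =>
    hz₀ v (hmono i R hi.le hv)
  refine ⟨?_, ?_, ?_⟩
  · intro i hi hb
    rw [Finset.nonempty_iff_ne_empty]
    intro hempty
    have hagree : ∀ v ∈ C i, z₀ v = h i v := by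
      intro v hv
      by_contra hne
      have : v ∈ soloBlindRoundBlock C h z₀ i := by
        simp [soloBlindRoundBlock, hv, hne]
      rw [hempty] at this
      simp at this
    exact hb (hcert i hi z₀ (hKR i hi) hagree).symm
  · intro i hi hb
    have hK' : ∀ v ∈ K i, soloBlindFlip z₀ (soloBlindRoundBlock C h z₀ i) v = y v := by
      intro v hv
      have hvD : v ∉ soloBlindRoundBlock C h z₀ i := by
        intro hvD
        have hvC : v ∈ C i := (Finset.mem_filter.mp hvD).1
        exact Finset.disjoint_left.mp (hCK i hi) hvC hv
      rw [soloBlindFlip_apply_of_not_mem hvD]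
      exact hKR i hi v hv
    have hC' : ∀ v ∈ C i, soloBlindFlip z₀ (soloBlindRoundBlock C h z₀ i) v = h i v := by
      intro v hv
      by_cases hvD : v ∈ soloBlindRoundBlock C h z₀ i
      · rw [soloBlindFlip_apply_of_mem hvD]
        have hne : z₀ v ≠ h i v := (Finset.mem_filter.mp hvD).2
        cases hz : z₀ v <;> cases hh : h i v <;> simp_all
      · rw [soloBlindFlip_apply_of_not_mem hvD]
        by_contra hne
        exact hvD (Finset.mem_filter.mpr ⟨hv, hne⟩)
    rw [hcert i hi _ hK' hC']
    exact hb
  · intro i j hi hj hij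
    wlog hlt : i < j generalizing i j
    · exact (this j i hj hi (Ne.symm hij) (lt_of_le_of_ne (not_lt.mp hlt) (Ne.symm hij))).symm
    rw [Finset.disjoint_left]
    intro v hvi hvj
    have hvCi : v ∈ C i := (Finset.mem_filter.mp hvi).1
    have hvCj : v ∈ C j := (Finset.mem_filter.mp hvj).1
    have hvK : v ∈ K j := hmono (i + 1) j hlt (hC i hi hvCi)
    exact Finset.disjoint_left.mp (hCK j hj) hvCj hvK

omit [Fintype V] in
/-- **Counting form.** If every point has at most `β` pairwise disjoint sensitive blocks, then at
any point `z₀` of the final subcube at most `β` rounds have a label `b i ≠ f z₀`. -/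
theorem soloBlind_rounds_card_le {f : (V → Bool) → Bool} {R : ℕ} {K : ℕ → Finset V}
    (hmono : ∀ i j, i ≤ j → K i ⊆ K j) {y : V → Bool} {h : ℕ → V → Bool} {C : ℕ → Finset V}
    {b : ℕ → Bool} (hC : ∀ i < R, C i ⊆ K (i + 1)) (hCK : ∀ i < R, Disjoint (C i) (K i))
    (hcert : ∀ i < R, ∀ z : V → Bool,
      (∀ v ∈ K i, z v = y v) → (∀ v ∈ C i, z v = h i v) → f z = b i)
    {β : ℕ}
    (hbs : ∀ z : V → Bool, ∀ 𝓓 : Finset (Finset V), (∀ B ∈ 𝓓, f (soloBlindFlip z B) ≠ f z) →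
      (∀ B ∈ 𝓓, ∀ B' ∈ 𝓓, B ≠ B' → Disjoint B B') → 𝓓.card ≤ β)
    {z₀ : V → Bool} (hz₀ : ∀ v ∈ K R, z₀ v = y v) :
    ((Finset.range R).filter fun i => b i ≠ f z₀).card ≤ β := by
  classical
  obtain ⟨hne, hsens, hdisj⟩ := soloBlind_rounds_disjoint_blocks hmono hC hCK hcert hz₀
  set I := (Finset.range R).filter fun i => b i ≠ f z₀ with hI
  have hmemI : ∀ i ∈ I, i < R ∧ b i ≠ f z₀ := fun i hi => by
    simpa [hI, Finset.mem_filter, Finset.mem_range] using hi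
  have hinj : Set.InjOn (soloBlindRoundBlock C h z₀) (I : Set ℕ) := by
    intro i hi j hj hij
    by_contra hne'
    have hd := hdisj i j (hmemI i hi).1 (hmemI j hj).1 hne'
    rw [hij] at hd
    have hempty : soloBlindRoundBlock C h z₀ j = ∅ := (Finset.disjoint_self_iff_empty _).mp hd
    have := hne j (hmemI j hj).1 (hmemI j hj).2
    rw [hempty] at this
    exact Finset.not_nonempty_empty this
  have hcard : (I.image (soloBlindRoundBlock C h z₀)).card = I.card :=
    Finset.card_image_of_injOn hinj
  rw [← hcard]
  apply hbs z₀
  · intro B hB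
    obtain ⟨i, hi, rfl⟩ := Finset.mem_image.mp hB
    exact hsens i (hmemI i hi).1 (hmemI i hi).2
  · intro B hB B' hB' hBB'
    obtain ⟨i, hi, rfl⟩ := Finset.mem_image.mp hB
    obtain ⟨j, hj, rfl⟩ := Finset.mem_image.mp hB'
    have hij : i ≠ j := fun hij => hBB' (by rw [hij])
    exact hdisj i j (hmemI i hi).1 (hmemI j hj).1 hij

omit [Fintype V] in
/-- **The learner stops correctly after `2β + 1` rounds**: if every point has at most `β`
pairwise disjoint sensitive blocks and more than `2β` certificate rounds have been played, then
`f` is constant on the final subcube; in particular the value at the final hypothesis is the value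
at the true table `y`. -/
theorem soloBlind_rounds_constant {f : (V → Bool) → Bool} {R : ℕ} {K : ℕ → Finset V}
    (hmono : ∀ i j, i ≤ j → K i ⊆ K j) {y : V → Bool} {h : ℕ → V → Bool} {C : ℕ → Finset V}
    {b : ℕ → Bool} (hC : ∀ i < R, C i ⊆ K (i + 1)) (hCK : ∀ i < R, Disjoint (C i) (K i))
    (hcert : ∀ i < R, ∀ z : V → Bool,
      (∀ v ∈ K i, z v = y v) → (∀ v ∈ C i, z v = h i v) → f z = b i)
    {β : ℕ}
    (hbs : ∀ z : V → Bool, ∀ 𝓓 : Finset (Finset V), (∀ B ∈ 𝓓, f (soloBlindFlip z B) ≠ f z) →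
      (∀ B ∈ 𝓓, ∀ B' ∈ 𝓓, B ≠ B' → Disjoint B B') → 𝓓.card ≤ β)
    (hR : 2 * β < R) :
    ∀ z₀ : V → Bool, (∀ v ∈ K R, z₀ v = y v) → f z₀ = f y := by
  classical
  intro z₀ hz₀
  by_contra hne
  have h0 := soloBlind_rounds_card_le hmono hC hCK hcert hbs hz₀
  have h1 := soloBlind_rounds_card_le hmono hC hCK hcert hbs (z₀ := y) (fun v _ => rfl)
  have hcover : Finset.range R ⊆
      ((Finset.range R).filter fun i => b i ≠ f z₀) ∪
        ((Finset.range R).filter fun i => b i ≠ f y) := by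
    intro i hi
    rw [Finset.mem_union, Finset.mem_filter, Finset.mem_filter]
    by_cases hb : b i = f z₀
    · right; exact ⟨hi, fun h' => hne (hb.symm.trans h')⟩
    · left; exact ⟨hi, hb⟩
  have := (Finset.card_le_card hcover).trans (Finset.card_union_le _ _)
  rw [Finset.card_range] at this
  omega

end Core

end Summit.QuantumAdvantage.QuantumAdvantage.Theorems
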